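import Mathlib
import Summits.ResolutionOfSingularities.ResolutionOfSingularities.Theorems.TropicalLinksInductiveStepExtIdealPresentation
import Summits.ResolutionOfSingularities.ResolutionOfSingularities.Theorems.TropicalLinksInductiveStepWeightZero

/-!
# TropicalLinks / InductiveStep — the principal open `U[G⁻¹]` is regular (brick P4b)

Route `ResolutionOfSingularities/TropicalLinks`, crux `InductiveStep` (stmt-ResolutionOfSingularities-17233),
line `split`, brick P4b, in support of stub `stub_sncClosureSchon` (hypothesis `h0` of the final glue
`tropicalLinks_isSchonIdeal_of_valuativeCharts`).

Setting: `k` a field, `I ⊆ R := k[ℤ^N] = AddMonoidAlgebra k (Fin N → ℤ)` an ideal, Laurent polynomials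
`G : Fin m → R` and `g = G j₀` one of them.  The principal open `U_g` of `U = V(I)` has coordinate ring
`A_g := Localization.Away (Ideal.Quotient.mk I g)`, assumed regular at every prime.  The route
re-embeds `U[G⁻¹]` into `𝔾_m^(N+m)` by the graph of the units `G_j`; its (inlined) extended ideal
`I' = ⟨ι(I), y_j − ι(G_j)⟩ ⊆ k[ℤ^(N+m)]` satisfies `k[ℤ^(N+m)] ⧸ I' ≃ₐ[k] (R ⧸ I)[(∏ G_j)⁻¹]`
(`tropicalLinks_extIdeal_presentation`).  Since `g ∣ ∏ G_j`, every prime of `(R ⧸ I)[(∏ G_j)⁻¹]`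
contracts to a prime `q` of `R ⧸ I` avoiding `g`, and the local ring there is `(R ⧸ I)_q`, which is
also a local ring of `A_g`; hence `k[ℤ^(N+m)] ⧸ I'` is regular at every prime
(`tropicalLinks_extIdeal_forall_prime_regular`).  The two localization steps are isolated in
`tropicalLinks_isRegularLocalRing_atPrime_of_away` and `tropicalLinks_forall_prime_regular_away_of_dvd`.
-/

-- single-problem summit: the doubled namespace component `ResolutionOfSingularities` is forced
set_option linter.dupNamespace false

namespace Summit.ResolutionOfSingularities.ResolutionOfSingularities.Theorems

open AddMonoidAlgebra

/-- Transport of regularity of the localization at a prime along an equality of prime ideals.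
[folklore] -/
theorem tropicalLinks_isRegularLocalRing_atPrime_congr {R : Type} [CommRing R] {p q : Ideal R}
    [p.IsPrime] [q.IsPrime] (h : p = q) [IsRegularLocalRing (Localization.AtPrime p)] :
    IsRegularLocalRing (Localization.AtPrime q) := by
  subst h
  assumption

/-- **Local rings of `R` off `V(g)` are local rings of `R[g⁻¹]`.** If `R[g⁻¹]` is regular at all of
its primes, then `R` is regular at every prime `q` with `g ∉ q`: indeed `q R[g⁻¹]` is a prime of
`R[g⁻¹]` contracting to `q`, and `R_q ≃ (R[g⁻¹])_{q R[g⁻¹]}`. [folklore] -/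
theorem tropicalLinks_isRegularLocalRing_atPrime_of_away {R : Type} [CommRing R] (g : R)
    (h : ∀ (P : Ideal (Localization.Away g)) [P.IsPrime], IsRegularLocalRing (Localization.AtPrime P))
    (q : Ideal R) [hq : q.IsPrime] (hg : g ∉ q) : IsRegularLocalRing (Localization.AtPrime q) := by
  have hd : Disjoint (Submonoid.powers g : Set R) ↑q := by
    rw [Set.disjoint_left]
    rintro _ ⟨n, rfl⟩ hn
    exact hg (hq.mem_of_pow_mem n hn)
  haveI : (Ideal.map (algebraMap R (Localization.Away g)) q).IsPrime :=
    IsLocalization.isPrime_of_isPrime_disjoint (Submonoid.powers g) _ q hq hd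
  haveI := h (Ideal.map (algebraMap R (Localization.Away g)) q)
  haveI : IsRegularLocalRing (Localization.AtPrime
      ((Ideal.map (algebraMap R (Localization.Away g)) q).comap
        (algebraMap R (Localization.Away g)))) :=
    IsRegularLocalRing.of_ringEquiv
      (IsLocalization.localizationLocalizationAtPrimeIsoLocalization (Submonoid.powers g)
        (Ideal.map (algebraMap R (Localization.Away g)) q)).symm.toRingEquiv
  exact tropicalLinks_isRegularLocalRing_atPrime_congr
    (IsLocalization.under_map_of_isPrime_disjoint (Submonoid.powers g) (Localization.Away g) hq hd)

/-- **A principal open of a regular principal open is regular.** If `R[g⁻¹]` is regular at all of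
its primes and `g ∣ x`, then `R[x⁻¹]` is regular at all of its primes: a prime `P` of `R[x⁻¹]`
contracts to a prime `q` of `R` with `x ∉ q`, hence `g ∉ q`, and `(R[x⁻¹])_P ≃ R_q`. [folklore] -/
theorem tropicalLinks_forall_prime_regular_away_of_dvd {R : Type} [CommRing R] {g x : R}
    (hgx : g ∣ x)
    (h : ∀ (P : Ideal (Localization.Away g)) [P.IsPrime], IsRegularLocalRing (Localization.AtPrime P)) :
    ∀ (P : Ideal (Localization.Away x)) [P.IsPrime], IsRegularLocalRing (Localization.AtPrime P) := by
  intro P hP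
  have hP' := (IsLocalization.isPrime_iff_isPrime_disjoint (Submonoid.powers x)
    (Localization.Away x) P).1 hP
  haveI : (P.comap (algebraMap R (Localization.Away x))).IsPrime := hP'.1
  have hx : x ∉ P.comap (algebraMap R (Localization.Away x)) := fun hx =>
    Set.disjoint_left.1 hP'.2 (Submonoid.mem_powers x) hx
  have hg : g ∉ P.comap (algebraMap R (Localization.Away x)) := fun hg =>
    hx (Ideal.mem_of_dvd _ hgx hg)
  haveI := tropicalLinks_isRegularLocalRing_atPrime_of_away g h
    (P.comap (algebraMap R (Localization.Away x))) hg
  exact IsRegularLocalRing.of_ringEquiv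
    (IsLocalization.localizationLocalizationAtPrimeIsoLocalization (Submonoid.powers x) P).toRingEquiv

/-- **Brick P4b: the coordinate ring of `U[G⁻¹]` is regular when `g` is among the `G_j` and `U_g`
is regular.** For a field `k`, an ideal `I ⊆ k[ℤ^N]`, Laurent polynomials `G : Fin m → k[ℤ^N]` with
`g = G j₀` for some `j₀`, if every localization at a prime of `(k[ℤ^N] ⧸ I)[g⁻¹]` is a regular
local ring, then so is every localization at a prime of the quotient of `k[ℤ^(N+m)]` by the route's
extended ideal `I' = ⟨ι(I), y_j − ι(G_j)⟩` — which is `(k[ℤ^N] ⧸ I)[(∏ G_j)⁻¹]` by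
`tropicalLinks_extIdeal_presentation`, a principal open of the regular `(k[ℤ^N] ⧸ I)[g⁻¹]` since
`g ∣ ∏ G_j`.  (The hypotheses that `I` is prime and `G_j ∉ I` are part of the brick's datum but
are not needed for this conclusion.) [folklore] -/
theorem tropicalLinks_extIdeal_forall_prime_regular : ∀ (k : Type) [Field k] (N m : ℕ) (I : Ideal (AddMonoidAlgebra k (Fin N → ℤ))) (G : Fin m → AddMonoidAlgebra k (Fin N → ℤ)) (g : AddMonoidAlgebra k (Fin N → ℤ)), I.IsPrime → (∀ j, G j ∉ I) → (∃ j, G j = g) → (∀ (P : Ideal (Localization.Away (Ideal.Quotient.mk I g))) [P.IsPrime], IsRegularLocalRing (Localization.AtPrime P)) → ∀ (P : Ideal (AddMonoidAlgebra k (Fin (N + m) → ℤ) ⧸ Ideal.span ((fun f : AddMonoidAlgebra k (Fin N → ℤ) => (AddMonoidAlgebra.ofCoeff (f.coeff.mapDomain fun v => Fin.append v (0 : Fin m → ℤ)) : AddMonoidAlgebra k (Fin (N + m) → ℤ))) '' (↑I : Set (AddMonoidAlgebra k (Fin N → ℤ))) ∪ Set.range (fun j : Fin m => AddMonoidAlgebra.single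 (Fin.append (0 : Fin N → ℤ) (Pi.single j (1 : ℤ))) (1 : k) - AddMonoidAlgebra.ofCoeff ((G j).coeff.mapDomain fun v => Fin.append v (0 : Fin m → ℤ)))))) [P.IsPrime], IsRegularLocalRing (Localization.AtPrime P) := by
  intro k _ N m I G g _ _ hg hreg
  obtain ⟨j₀, hj₀⟩ := hg
  obtain ⟨e, -, -⟩ := tropicalLinks_extIdeal_presentation k N m I G
    (Ideal.Quotient.mk I (∏ j, G j)) rfl
  have hdvd : Ideal.Quotient.mk I g ∣ Ideal.Quotient.mk I (∏ j, G j) :=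
    map_dvd (Ideal.Quotient.mk I) (hj₀ ▸ Finset.dvd_prod_of_mem G (Finset.mem_univ j₀))
  exact tropicalLinks_forall_prime_regular_of_ringEquiv e.symm.toRingEquiv
    (tropicalLinks_forall_prime_regular_away_of_dvd hdvd hreg)

end Summit.ResolutionOfSingularities.ResolutionOfSingularities.Theorems
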